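import Literature.Probability.Percolation.KozmaNitzanPreFKG
import HarnessLib

/-!
# `NoHeavyLowerTail` (stmt-CriticalPhenomena-4575) — the pair-exchange inequality for relay counts
# (Kozma–Nitzan's Theorem 1 with "`↔ b`" replaced by "heavy") and the hypothesis-free bound on the gluing gain

Support file (prover `prim-hp-5`, hull-port cell, T-form calculus, gen 6; `--supports stmt-CriticalPhenomena-4575`).
No definitions, no named facts, no sorries.  `μ = prodBernoulli w` on a finite vertex type `V`, relays `A : Finset V`,
level `j`, `N_v = |{a ∈ A : v ↔ a}|`, "`v` heavy" `= {N_v > j}`, "`x ~ B`" `= {x ↔ y} ∪ {x ↔ z}` for `B = {y, z}`.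

The crux is reduced (`Theorems.noHeavyLowerTail_of_gluedWitness₂`, file `…TformGluedWitness`) to GLUE-ADM: a relay that
is a T-witness for each member of a non-relay set `B` is a T-witness for the glued set.  In "heavy" language GLUE-ADM reads
`μ(U'_x) ≤ μ(V_B) + min_c μ(Z_B ∩ U_c)` given `μ(U_x) ≤ μ(V_v) + min_c μ(Z_v ∩ U_c)` (`v ∈ B`), where
`U'_x ∖ U_x = {x ~ B, N_x ≤ j < N_B}` is the GLUING GAIN of `x`.  This file proves the hypothesis-free part of that
statement for `|B| = 2` — the control of the gain by the heaviness increase of the lighter member — by porting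
Kozma–Nitzan's proof of their Theorem 1 / Lemma 4 (arXiv:2401.12397, pp. 7–9) from connection events `{v ↔ b}` to the
relay-count events `{N_v > j}` (both are increasing events read on the open cluster of `v`, which is all the
van den Berg–Häggström–Kahn inequalities need):

* `heavy_pairExchange` — **pair exchange** (KN Thm 1 analogue): for ANY vertices `x, y, z`,
  `min_{v ∈ {y,z}} μ(x ~ B, N_v > j) ≤ μ(x ~ B, N_x > j)`: a vertex attached to the pair is at least as likely to be
  heavy as the lighter member is (on the attached event).  Proof = KN pp. 7–8 verbatim: subtract the common event
  `{x ↔ v, N_v > j}`, then BHK 2006 Thm 1.3 (inside `C_z`) and Thm 1.4 (across `C_z`, `C_y`) given `{y ↮ z}`, four times.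
* `gluingGain_le` — **the gain bound** (KN Lemma 4 analogue, = the memo's GLUE-MAX0): for some member `v ∈ {y, z}`,
  `μ(x ~ B, N_x ≤ j, N_B > j) ≤ μ(x ~ B, N_B > j, N_v ≤ j)`, where `N_B = |{a ∈ A : y ↔ a ∨ z ↔ a}|`.

What remains of GLUE-ADM for `|B| = 2` after this file is the FALLBACK part (the `min_c μ(Z ∩ U_c)` terms); see the seat
memo `run/shared/lean/prim/prim-hp-5/OBSERVER-SET.md` §11.
-/

noncomputable section

namespace Summit.CriticalPhenomena.PercolationContinuityZ3.Theorems

open MeasureTheory Set Literature.Probability.LatticeModels Literature.Probability.Percolation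
open Literature.Probability.Percolation.KNPreFKG
open scoped Classical BigOperators

variable {V : Type*}

/-- The family of edge sets from which more than `j` relays of `A` are seen from `s` ("`s` is heavy") is an upper
family (adding open edges only adds relays to the cluster). [folklore] -/
theorem isUpperSet_heavyFamily (A : Finset V) (s : V) (j : ℕ) :
    IsUpperSet {C : Set (Sym2 V) | j < (A.filter fun a => a = s ∨ ∃ e ∈ C, a ∈ e).card} := by
  intro C C' hCC' hC
  simp only [mem_setOf_eq] at hC ⊢
  refine lt_of_lt_of_le hC (Finset.card_le_card fun a ha => ?_)
  rw [Finset.mem_filter] at ha ⊢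
  rcases ha with ⟨haA, h | ⟨e, he, hae⟩⟩
  · exact ⟨haA, Or.inl h⟩
  · exact ⟨haA, Or.inr ⟨e, hCC' he, hae⟩⟩

/-- `{N_s > j}` is the event that the open edge cluster `C_s` lies in the heavy family (dictionary
`s ↔ a ⟺ a = s ∨ ∃ e ∈ C_s, a ∈ e`). [cite: VandenbergHaggstromKahn2005, §1 p. 3 (events read on `C_s`)] -/
theorem setOf_heavy_eq (A : Finset V) (s : V) (j : ℕ) :
    {ω : BondConfig V | j < (A.filter fun a => ω ∈ openConn s a).card} =
      {ω | openEdgeCluster ω s ∈ {C : Set (Sym2 V) | j < (A.filter fun a => a = s ∨ ∃ e ∈ C, a ∈ e).card}} := by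
  ext ω
  simp only [mem_setOf_eq]
  rw [Finset.filter_congr fun a _ => show ω ∈ openConn s a ↔ (a = s ∨ ∃ e ∈ openEdgeCluster ω s, a ∈ e) from
    reachable_iff_exists_mem_openEdgeCluster ω s a]

/-- Joined vertices see the same relays: on `{x ↔ y}` the relay filters of `x` and `y` coincide. [folklore] -/
theorem filter_openConn_eq_of_mem {ω : BondConfig V} {x y : V} (h : ω ∈ openConn x y) (A : Finset V) :
    (A.filter fun a => ω ∈ openConn x a) = (A.filter fun a => ω ∈ openConn y a) :=
  Finset.filter_congr fun a _ =>
    ⟨fun hxa => show (openGraph ω).Reachable y a from (SimpleGraph.Reachable.symm h).trans hxa,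
     fun hya => show (openGraph ω).Reachable x a from SimpleGraph.Reachable.trans h hya⟩

variable [Fintype V]

/-- **Pair exchange for relay counts** (Kozma–Nitzan's Theorem 1 with `{· ↔ b}` replaced by `{N_· > j}`).
For vertices `x, y, z` of a finite weighted graph, relays `A`, level `j`, and `{x ~ B} = {x ↔ y} ∪ {x ↔ z}`:
`min( μ(x ~ B, N_y > j), μ(x ~ B, N_z > j) ) ≤ μ(N_x > j, x ~ B)`.
Proof as printed for KN Thm 1 (pp. 7–8): after removing the common event `{x ↔ v, N_v > j}` the two differences are
`μ(x↔z, N_z>j, y↮z) − μ(x↔z, N_y>j, y↮z)` and its mirror image, and BHK 2006 Thm 1.3 (in `C_z`) / Thm 1.4 (`C_z` versus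
`C_y`) given `{y ↮ z}` bound them below by `φ(z)·(μ(N_z>j, y↮z) − μ(N_y>j, y↮z))` and its mirror image, one of which is
nonnegative. [cite: KozmaNitzan2024, Thm. 1 (pp. 7–8)] [cite: VandenbergHaggstromKahn2005, Thms. 1.3–1.4 (pp. 6–7)] -/
theorem heavy_pairExchange (w : Sym2 V → unitInterval) (A : Finset V) (x y z : V) (j : ℕ) :
    min ((prodBernoulli w).real ((openConn x y ∪ openConn x z) ∩
            {ω : BondConfig V | j < (A.filter fun a => ω ∈ openConn y a).card}))
        ((prodBernoulli w).real ((openConn x y ∪ openConn x z) ∩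
            {ω : BondConfig V | j < (A.filter fun a => ω ∈ openConn z a).card})) ≤
      (prodBernoulli w).real ({ω : BondConfig V | j < (A.filter fun a => ω ∈ openConn x a).card} ∩
        (openConn x y ∪ openConn x z)) := by
  classical
  by_cases h12 : y = z
  · -- `B` is a singleton: `{x ↔ y, N_y > j} = {N_x > j, x ↔ y}`
    subst h12
    rw [union_self]
    refine (min_le_left _ _).trans (measureReal_mono ?_)
    rintro ω ⟨hxy, hy⟩
    refine ⟨?_, hxy⟩
    simp only [mem_setOf_eq] at hy ⊢
    rwa [filter_openConn_eq_of_mem hxy]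
  set μ := prodBernoulli w with hμ
  set O₁ : Set (BondConfig V) := openConn x y with hO₁
  set O₂ : Set (BondConfig V) := openConn x z with hO₂
  set Ob : Set (BondConfig V) := {ω : BondConfig V | j < (A.filter fun a => ω ∈ openConn x a).card} with hOb
  set B₁ : Set (BondConfig V) := {ω : BondConfig V | j < (A.filter fun a => ω ∈ openConn y a).card} with hB₁
  set B₂ : Set (BondConfig V) := {ω : BondConfig V | j < (A.filter fun a => ω ∈ openConn z a).card} with hB₂
  set D : Set (BondConfig V) := {ω | ¬ (openGraph ω).Reachable y z} with hD
  set E : Set (BondConfig V) := Ob ∩ (O₁ ∪ O₂) with hE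
  set F₁ : Set (BondConfig V) := (O₁ ∪ O₂) ∩ B₁ with hF₁
  set F₂ : Set (BondConfig V) := (O₁ ∪ O₂) ∩ B₂ with hF₂
  have hsplit : ∀ S T : Set (BondConfig V), μ.real S = μ.real (S ∩ T) + μ.real (S ∩ Tᶜ) := by
    intro S T
    rw [← measureReal_inter_add_sdiff (s := S) (MeasurableSet.of_discrete : MeasurableSet T), Set.sdiff_eq]
  -- dictionary between the relay counts of joined vertices
  have hcnt : ∀ {ω : BondConfig V} {u v : V}, (openGraph ω).Reachable u v →
      ((j < (A.filter fun a => ω ∈ openConn u a).card) ↔ (j < (A.filter fun a => ω ∈ openConn v a).card)) := by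
    intro ω u v h
    rw [filter_openConn_eq_of_mem (show ω ∈ openConn u v from h)]
  -- the two "subtract the common event" identities
  have hE1 : E ∩ O₁ = F₁ ∩ O₁ := by
    ext ω
    simp only [mem_inter_iff, mem_union, hE, hF₁, hO₁, hO₂, hOb, hB₁, openConn, mem_setOf_eq]
    constructor
    · rintro ⟨⟨hb, _⟩, h1⟩
      exact ⟨⟨Or.inl h1, (hcnt h1).1 hb⟩, h1⟩
    · rintro ⟨⟨_, hb⟩, h1⟩
      exact ⟨⟨(hcnt h1).2 hb, Or.inl h1⟩, h1⟩
  have hE1c : E ∩ O₁ᶜ = O₂ ∩ B₂ ∩ D := by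
    ext ω
    simp only [mem_inter_iff, mem_union, mem_compl_iff, hE, hO₁, hO₂, hOb, hB₂, hD, openConn,
      mem_setOf_eq]
    constructor
    · rintro ⟨⟨hb, h1 | h2⟩, hn1⟩
      · exact absurd h1 hn1
      · exact ⟨⟨h2, (hcnt h2).1 hb⟩, fun h => hn1 (h2.trans h.symm)⟩
    · rintro ⟨⟨h2, hb⟩, hn⟩
      exact ⟨⟨(hcnt h2).2 hb, Or.inr h2⟩, fun h1 => hn (h1.symm.trans h2)⟩
  have hF1c : F₁ ∩ O₁ᶜ = O₂ ∩ B₁ ∩ D := by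
    ext ω
    simp only [mem_inter_iff, mem_union, mem_compl_iff, hF₁, hO₁, hO₂, hB₁, hD, openConn,
      mem_setOf_eq]
    constructor
    · rintro ⟨⟨h1 | h2, hb⟩, hn1⟩
      · exact absurd h1 hn1
      · exact ⟨⟨h2, hb⟩, fun h => hn1 (h2.trans h.symm)⟩
    · rintro ⟨⟨h2, hb⟩, hn⟩
      exact ⟨⟨Or.inr h2, hb⟩, fun h1 => hn (h1.symm.trans h2)⟩
  have hE2 : E ∩ O₂ = F₂ ∩ O₂ := by
    ext ω
    simp only [mem_inter_iff, mem_union, hE, hF₂, hO₁, hO₂, hOb, hB₂, openConn, mem_setOf_eq]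
    constructor
    · rintro ⟨⟨hb, _⟩, h2⟩
      exact ⟨⟨Or.inr h2, (hcnt h2).1 hb⟩, h2⟩
    · rintro ⟨⟨_, hb⟩, h2⟩
      exact ⟨⟨(hcnt h2).2 hb, Or.inr h2⟩, h2⟩
  have hE2c : E ∩ O₂ᶜ = O₁ ∩ B₁ ∩ D := by
    ext ω
    simp only [mem_inter_iff, mem_union, mem_compl_iff, hE, hO₁, hO₂, hOb, hB₁, hD, openConn,
      mem_setOf_eq]
    constructor
    · rintro ⟨⟨hb, h1 | h2⟩, hn2⟩
      · exact ⟨⟨h1, (hcnt h1).1 hb⟩, fun h => hn2 (h1.trans h)⟩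
      · exact absurd h2 hn2
    · rintro ⟨⟨h1, hb⟩, hn⟩
      exact ⟨⟨(hcnt h1).2 hb, Or.inl h1⟩, fun h2 => hn (h1.symm.trans h2)⟩
  have hF2c : F₂ ∩ O₂ᶜ = O₁ ∩ B₂ ∩ D := by
    ext ω
    simp only [mem_inter_iff, mem_union, mem_compl_iff, hF₂, hO₁, hO₂, hB₂, hD, openConn,
      mem_setOf_eq]
    constructor
    · rintro ⟨⟨h1 | h2, hb⟩, hn2⟩
      · exact ⟨⟨h1, hb⟩, fun h => hn2 (h1.trans h)⟩
      · exact absurd h2 hn2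
    · rintro ⟨⟨h1, hb⟩, hn⟩
      exact ⟨⟨Or.inl h1, hb⟩, fun h2 => hn (h1.symm.trans h2)⟩
  have hdiff1 : μ.real E - μ.real F₁ = μ.real (O₂ ∩ B₂ ∩ D) - μ.real (O₂ ∩ B₁ ∩ D) := by
    rw [hsplit E O₁, hsplit F₁ O₁, hE1, hE1c, hF1c]
    ring
  have hdiff2 : μ.real E - μ.real F₂ = μ.real (O₁ ∩ B₁ ∩ D) - μ.real (O₁ ∩ B₂ ∩ D) := by
    rw [hsplit E O₂, hsplit F₂ O₂, hE2, hE2c, hF2c]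
    ring
  -- "Applying BHK 4 times", given `D = {y ↮ z}`
  have hD1 : {ω : BondConfig V | ∀ v ∈ ({z} : Set V), ¬ (openGraph ω).Reachable y v} = D := by
    ext ω
    simp [hD]
  have hD2 : {ω : BondConfig V | ∀ v ∈ ({y} : Set V), ¬ (openGraph ω).Reachable z v} = D := by
    ext ω
    simp only [mem_setOf_eq, mem_singleton_iff, forall_eq, hD]
    exact not_congr ⟨SimpleGraph.Reachable.symm, SimpleGraph.Reachable.symm⟩
  have hD3 : {ω : BondConfig V | ¬ (openGraph ω).Reachable z y} = D := by
    ext ω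
    simp only [mem_setOf_eq, hD]
    exact not_congr ⟨SimpleGraph.Reachable.symm, SimpleGraph.Reachable.symm⟩
  -- (i) `μ(D, x↔z) μ(D, N_z>j) ≤ μ(D) μ(D, x↔z, N_z>j)` (Thm. 1.3 in `C_z`)
  have h_i := bhk_one_upper_upper w z ({y} : Set V) (by simpa using Ne.symm h12)
    (isUpperSet_connFamily z x) (isUpperSet_heavyFamily A z j)
  rw [hD2, ← openConn_eq_setOf_connFamily, ← setOf_heavy_eq, openConn_symm z x] at h_i
  -- (ii) `μ(D) μ(D, x↔z, N_y>j) ≤ μ(D, x↔z) μ(D, N_y>j)` (Thm. 1.4, `C_z` and `C_y`)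
  have h_ii := bhk_two_upper_upper w z y (Ne.symm h12) (isUpperSet_connFamily z x)
    (isUpperSet_heavyFamily A y j)
  rw [hD3, ← openConn_eq_setOf_connFamily, ← setOf_heavy_eq, openConn_symm z x] at h_ii
  -- (iii) `μ(D, x↔y) μ(D, N_y>j) ≤ μ(D) μ(D, x↔y, N_y>j)` (Thm. 1.3 in `C_y`)
  have h_iii := bhk_one_upper_upper w y ({z} : Set V) (by simpa using h12)
    (isUpperSet_connFamily y x) (isUpperSet_heavyFamily A y j)
  rw [hD1, ← openConn_eq_setOf_connFamily, ← setOf_heavy_eq, openConn_symm y x] at h_iii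
  -- (iv) `μ(D) μ(D, x↔y, N_z>j) ≤ μ(D, x↔y) μ(D, N_z>j)` (Thm. 1.4, `C_y` and `C_z`)
  have h_iv := bhk_two_upper_upper w y z h12 (isUpperSet_connFamily y x)
    (isUpperSet_heavyFamily A z j)
  rw [← openConn_eq_setOf_connFamily, ← setOf_heavy_eq, openConn_symm y x] at h_iv
  -- normalise the intersections
  have e1 : D ∩ (O₂ ∩ B₂) = O₂ ∩ B₂ ∩ D := inter_comm _ _
  have e2 : D ∩ (O₂ ∩ B₁) = O₂ ∩ B₁ ∩ D := inter_comm _ _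
  have e3 : D ∩ (O₁ ∩ B₁) = O₁ ∩ B₁ ∩ D := inter_comm _ _
  have e4 : D ∩ (O₁ ∩ B₂) = O₁ ∩ B₂ ∩ D := inter_comm _ _
  simp only [← hD, ← hO₁, ← hO₂, ← hB₁, ← hB₂] at h_i h_ii h_iii h_iv
  rw [e1] at h_i
  rw [e2] at h_ii
  rw [e3] at h_iii
  rw [e4] at h_iv
  -- combine
  by_cases hD0 : μ.real D = 0
  · have hz : ∀ S : Set (BondConfig V), μ.real (S ∩ D) = 0 := fun S =>
      le_antisymm ((measureReal_mono inter_subset_right).trans hD0.le) measureReal_nonneg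
    have : μ.real E = μ.real F₁ := by
      have := hdiff1
      rw [hz, hz, sub_self, sub_eq_zero] at this
      exact this
    exact (min_le_left _ _).trans this.symm.le
  · have hDpos : 0 < μ.real D := lt_of_le_of_ne measureReal_nonneg (Ne.symm hD0)
    rcases le_total (μ.real (D ∩ B₁)) (μ.real (D ∩ B₂)) with ht | ht
    · -- `μ(D, N_y>j) ≤ μ(D, N_z>j)`: then `μ(E) ≥ μ(F₁)`
      refine (min_le_left _ _).trans ?_
      have key : μ.real D * (μ.real E - μ.real F₁) ≥ 0 := by
        rw [hdiff1, mul_sub]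
        have hs2 : 0 ≤ μ.real (D ∩ O₂) := measureReal_nonneg
        nlinarith [h_i, h_ii, mul_le_mul_of_nonneg_left ht hs2]
      nlinarith [key]
    · refine (min_le_right _ _).trans ?_
      have key : μ.real D * (μ.real E - μ.real F₂) ≥ 0 := by
        rw [hdiff2, mul_sub]
        have hs1 : 0 ≤ μ.real (D ∩ O₁) := measureReal_nonneg
        nlinarith [h_iii, h_iv, mul_le_mul_of_nonneg_left ht hs1]
      nlinarith [key]

/-- **The gluing gain is paid by the lighter member** (Kozma–Nitzan's Lemma 4 with `{· ↔ b}` replaced by `{N_· > j}`;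
the hypothesis-free "T-part" of GLUE-ADM for `|B| = 2`).  With `{x ~ B} = {x ↔ y} ∪ {x ↔ z}` and
`N_B = |{a ∈ A : y ↔ a ∨ z ↔ a}|` (the relay count of the glued pair):
`μ(x ~ B, N_B > j, N_x ≤ j) ≤ max( μ(x ~ B, N_B > j, N_y ≤ j), μ(x ~ B, N_B > j, N_z ≤ j) )`,
i.e. the gain `Φ_K(x) − Φ_{K/B}(x) = μ(x ~ B, N_x ≤ j < N_B)` of ANY vertex `x` from gluing `B` is at most the mass of
"`x` attached to `B`, `B` heavy, but the member `v` light" for one of the two members `v`.  From `heavy_pairExchange`: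
on `{x ~ B}` one has `{N_x > j} ⊆ {N_B > j} ⊇ {N_v > j}`, so both sides are `μ(x ~ B, N_B > j)` minus the two sides of
the pair-exchange inequality. [cite: KozmaNitzan2024, Lemma 4 and Remark (9) (pp. 9–10)] -/
theorem gluingGain_le (w : Sym2 V → unitInterval) (A : Finset V) (x y z : V) (j : ℕ) :
    (prodBernoulli w).real ((openConn x y ∪ openConn x z) ∩
        {ω : BondConfig V | j < (A.filter fun a => ω ∈ openConn y a ∨ ω ∈ openConn z a).card} ∩
        {ω : BondConfig V | j < (A.filter fun a => ω ∈ openConn x a).card}ᶜ) ≤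
      max ((prodBernoulli w).real ((openConn x y ∪ openConn x z) ∩
            {ω : BondConfig V | j < (A.filter fun a => ω ∈ openConn y a ∨ ω ∈ openConn z a).card} ∩
            {ω : BondConfig V | j < (A.filter fun a => ω ∈ openConn y a).card}ᶜ))
        ((prodBernoulli w).real ((openConn x y ∪ openConn x z) ∩
            {ω : BondConfig V | j < (A.filter fun a => ω ∈ openConn y a ∨ ω ∈ openConn z a).card} ∩
            {ω : BondConfig V | j < (A.filter fun a => ω ∈ openConn z a).card}ᶜ)) := by
  classical
  set μ := prodBernoulli w with hμ
  set XB : Set (BondConfig V) := openConn x y ∪ openConn x z with hXB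
  set Ux : Set (BondConfig V) := {ω : BondConfig V | j < (A.filter fun a => ω ∈ openConn x a).card} with hUx
  set Vy : Set (BondConfig V) := {ω : BondConfig V | j < (A.filter fun a => ω ∈ openConn y a).card} with hVy
  set Vz : Set (BondConfig V) := {ω : BondConfig V | j < (A.filter fun a => ω ∈ openConn z a).card} with hVz
  set VB : Set (BondConfig V) :=
    {ω : BondConfig V | j < (A.filter fun a => ω ∈ openConn y a ∨ ω ∈ openConn z a).card} with hVB
  have hsplit : ∀ S T : Set (BondConfig V), μ.real S = μ.real (S ∩ T) + μ.real (S ∩ Tᶜ) := by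
    intro S T
    rw [← measureReal_inter_add_sdiff (s := S) (MeasurableSet.of_discrete : MeasurableSet T), Set.sdiff_eq]
  -- monotonicity of the relay counts: `N_y, N_z ≤ N_B`, and `N_x ≤ N_B` on `{x ~ B}`
  have hyB : Vy ⊆ VB := by
    intro ω hω
    simp only [hVy, hVB, mem_setOf_eq] at hω ⊢
    exact lt_of_lt_of_le hω (Finset.card_le_card fun a ha => by
      rw [Finset.mem_filter] at ha ⊢; exact ⟨ha.1, Or.inl ha.2⟩)
  have hzB : Vz ⊆ VB := by
    intro ω hω
    simp only [hVz, hVB, mem_setOf_eq] at hω ⊢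
    exact lt_of_lt_of_le hω (Finset.card_le_card fun a ha => by
      rw [Finset.mem_filter] at ha ⊢; exact ⟨ha.1, Or.inr ha.2⟩)
  have hxB : XB ∩ Ux ⊆ VB := by
    rintro ω ⟨hX, hU⟩
    simp only [hUx, hVB, mem_setOf_eq] at hU ⊢
    refine lt_of_lt_of_le hU (Finset.card_le_card fun a ha => ?_)
    rw [Finset.mem_filter] at ha ⊢
    refine ⟨ha.1, ?_⟩
    rcases hX with h | h
    · exact Or.inl (show (openGraph ω).Reachable y a from (SimpleGraph.Reachable.symm h).trans ha.2)
    · exact Or.inr (show (openGraph ω).Reachable z a from (SimpleGraph.Reachable.symm h).trans ha.2)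
  -- the three sets as differences from `XB ∩ VB`
  have eU : XB ∩ VB ∩ Ux = Ux ∩ XB := by
    ext ω; constructor
    · rintro ⟨⟨hX, _⟩, hU⟩; exact ⟨hU, hX⟩
    · rintro ⟨hU, hX⟩; exact ⟨⟨hX, hxB ⟨hX, hU⟩⟩, hU⟩
  have eY : XB ∩ VB ∩ Vy = XB ∩ Vy := by
    ext ω; constructor
    · rintro ⟨⟨hX, _⟩, hv⟩; exact ⟨hX, hv⟩
    · rintro ⟨hX, hv⟩; exact ⟨⟨hX, hyB hv⟩, hv⟩
  have eZ : XB ∩ VB ∩ Vz = XB ∩ Vz := by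
    ext ω; constructor
    · rintro ⟨⟨hX, _⟩, hv⟩; exact ⟨hX, hv⟩
    · rintro ⟨hX, hv⟩; exact ⟨⟨hX, hzB hv⟩, hv⟩
  have hU' : μ.real (XB ∩ VB ∩ Uxᶜ) = μ.real (XB ∩ VB) - μ.real (Ux ∩ XB) := by
    rw [hsplit (XB ∩ VB) Ux, eU]; ring
  have hY' : μ.real (XB ∩ VB ∩ Vyᶜ) = μ.real (XB ∩ VB) - μ.real (XB ∩ Vy) := by
    rw [hsplit (XB ∩ VB) Vy, eY]; ring
  have hZ' : μ.real (XB ∩ VB ∩ Vzᶜ) = μ.real (XB ∩ VB) - μ.real (XB ∩ Vz) := by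
    rw [hsplit (XB ∩ VB) Vz, eZ]; ring
  have hpe := heavy_pairExchange w A x y z j
  simp only [← hμ, ← hXB, ← hUx, ← hVy, ← hVz] at hpe
  rw [hU', hY', hZ']
  rcases min_le_iff.1 hpe with h | h
  · exact le_max_of_le_left (by linarith)
  · exact le_max_of_le_right (by linarith)

end Summit.CriticalPhenomena.PercolationContinuityZ3.Theorems

end
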